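import Summits.NavierStokesRegularity.FluidComputer.GateBudgetRungClock
import HarnessLib

/-!
# GateBudget part 87 (file 1/2) — the sharp cold increment law and relight alternative (§252–§253)

Cell `pub-fluidc`, blueprint seat bp1 (gen 37, fourth item: SPEC-INPUT-bp1 §BO(4)(a)); namespace
`Summit.NavierStokesRegularity.FluidComputer.GateBudget`, headline member
`RotorKnob.rotorCircuit K K¹⁰ ε ρ` from `delayInit` (5.6), `K ≥ 16`, lattice window
`200ε/K²⁰ ≤ ρ² ≤ 2ε/K¹⁰`, `ε² ≤ 1/(6K²⁰)` (`σ = ρ²e^{-K¹⁰}`, `μ = ε⁻¹K¹⁰`); modes `0 = a`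
(carrier), `1 = b` (clock), `2 = c` (trigger), `3 = d` (transfer), `4 = ã` (output),
`P = d² + ã²`. Imports part 84 (`GateBudgetRungClock`), hence parts 56–62, 73, 77, 80. Part 87 is
two files (the 400-line cap): this one (§252–§253) and `GateBudgetColdHalfSharp` (§254–§255).
HONEST FRAMING: a low prior, high value-of-information experiment on Tao's machine paradigm;
NOT a claim that NS blows up. Nothing whatsoever is proved about the Navier–Stokes equations.
[cite: Tao2016AveragedNS, §5.5 Theorem 5.3, (5.5), (5.6), (b-eq), (c-eq), (d-eq), (ta-eq),
(energy-con), (est)]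

WHY (SPEC-INPUT-bp1 §BO(4)(a)). Part 84 §247 relights a doused member at `θ' ≥ θ₁ - 43/K⁹`
(or clipped into `[1.39999, 1.41422]`) and parts 85/86 pay `λ = 43/K⁹ + 242 log K/K¹⁰` per
rung. The `43` is bookkeeping of part 57 §172: its carrier band charges the cold pair dose at
transfer level `|d| ≤ 1` (`|P - P₀| ≤ 6/K⁹`) plus two roundings (`b² + c² ≤ 1/K⁹`,
`μc² ≤ ε/K⁹`), whence slopes `1 - P₀ - 8/K⁹`, `1 - P₀ + 6/K⁹` and the debt loss
`2θ₁·14/K⁹/s_u ≈ 43/K⁹` (part 62 §193). Part 84 shows `|d| ≤ |d(T')| + 3/K⁹ =: d₁` on the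
cold window, so the SAME bricks of part 56 (`knob_pair_dose` at dose `d₁`, `carrier_bracket`,
`clock_bracket`) give slopes `s_l' = 1 - P₀ - 6d₁/K⁹ - 1/K¹⁹`, `s_u' = 1 - P₀ + 6d₁/K⁹` — this
file — and the loss `2θ₁(s_u' - s_l')/s_u' ≤ 37(d₁ + 1/K⁹)/K⁹` (file 2/2), `O(1/K¹³)` on the
ladder, far below the pulse's `242 log K/K¹⁰`. Nothing of parts 57–62 is re-run (part 58 §179
`knob_cold_quiet_seed` serves as is, its amplification hypothesis being in the OLD slope
`s_u = 1 - P₀ + 6/K⁹ ≥ s_u'`).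

WHAT IS PROVED. §252 `sharp_cold_numerics`; `knob_cold_increment_sharp`:
`εs_l'(t - s) ≤ b(t) - b(s) ≤ εs_u'(t - s)` on a cold window `[T, u]`, `u ≤ T + 3`, with
`c ≤ ρ²/K⁹` and `|d| ≤ d₁`. §253 `knob_cold_action_upper_sharp`: `B(t) - B(T) ≤
ε(t - T)(s_u'(t - T)/2 - θ)` for a clock action `B`; `knob_relight_lower_sharp`:
`r > T + 2θ/s_u' ∨ s_u(r - tz)²/2 > 1 - 10 log K/K¹⁰` at a relight time `r` (`c(r) = ρ²/K⁹`).
Honest limits: pure window bookkeeping — no existence statement here (the window, the clock zero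
and the relight time are part 84's); constants generous; nothing about Navier–Stokes.
-/

noncomputable section

namespace Summit.NavierStokesRegularity.FluidComputer.GateBudget

open Real Set
open Literature.Analysis.FluidPDE.Tao2016AveragedNS

variable {K ε ρ : ℝ} {X : ℝ → Fin 5 → ℝ}

/-! ## §252 The sharp numerics and the sharp clock increment law -/

/-- §252 SHARP COLD NUMERICS: on the lattice window, `25ε² + (ρ²/K⁹)² ≤ 5/K²⁰` (clock and
trigger inside the carrier identity), `μ(ρ²/K⁹)² ≤ 4ε/K²⁸` (the clock drag) and
`5/K²⁰ + 4/K²⁸ ≤ 1/K¹⁹` (both rounded into the lower slope). [derived: this file §252] -/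
theorem sharp_cold_numerics (hK : 16 ≤ K) (hε : 0 < ε) (hεK : ε ^ 2 ≤ 1 / (6 * K ^ 20))
    (hρ : 0 < ρ) (hhi : K ^ 10 * ρ ^ 2 ≤ 2 * ε) :
    25 * ε ^ 2 + (ρ ^ 2 / K ^ 9) ^ 2 ≤ 5 / K ^ 20 ∧
      ε⁻¹ * K ^ 10 * (ρ ^ 2 / K ^ 9) ^ 2 ≤ ε * (4 / K ^ 28) ∧
      5 / K ^ 20 + 4 / K ^ 28 ≤ 1 / K ^ 19 := by
  have hK0 : (0 : ℝ) < K := by linarith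
  have hK1 : (1 : ℝ) ≤ K := by linarith
  have hK9 : (0 : ℝ) < K ^ 9 := by positivity
  have hK19 : (0 : ℝ) < K ^ 19 := by positivity
  have hK20 : (0 : ℝ) < K ^ 20 := by positivity
  have h169 : (16 : ℝ) ^ 9 ≤ K ^ 9 := pow_le_pow_left₀ (by norm_num) hK 9
  have h18 : (16 : ℝ) ^ 18 ≤ K ^ 18 := pow_le_pow_left₀ (by norm_num) hK 18
  have e1 : ε ^ 2 * (6 * K ^ 20) ≤ 1 := by rwa [le_div_iff₀ (by positivity)] at hεK
  have hε1 : ε ≤ 1 := by nlinarith [one_le_pow₀ hK1 (n := 20)]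
  have hρK : ρ ^ 2 ≤ 2 / K ^ 10 := by rw [le_div_iff₀ (by positivity)]; nlinarith
  refine ⟨?_, ?_, ?_⟩
  · have t1 : 25 * ε ^ 2 * K ^ 20 ≤ 25 / 6 := by nlinarith [e1]
    have t2 : (ρ ^ 2 / K ^ 9) ^ 2 ≤ 1 / (2 * K ^ 20) := by
      have h1 : ρ ^ 2 / K ^ 9 ≤ 2 / K ^ 10 / K ^ 9 := div_le_div_of_nonneg_right hρK hK9.le
      refine (pow_le_pow_left₀ (by positivity) h1 2).trans ?_
      rw [div_div, div_pow, div_le_div_iff₀ (by positivity) (by positivity)]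
      nlinarith [h18, hK20]
    have t3 : (ρ ^ 2 / K ^ 9) ^ 2 * K ^ 20 ≤ 1 / 2 := by
      have h := mul_le_mul_of_nonneg_right t2 hK20.le
      have e : 1 / (2 * K ^ 20) * K ^ 20 = 1 / 2 := by field_simp
      linarith [h, e]
    rw [le_div_iff₀ hK20]
    nlinarith [t1, t3]
  · have r3 : (K ^ 10 * ρ ^ 2) ^ 2 ≤ (2 * ε) ^ 2 := pow_le_pow_left₀ (by positivity) hhi 2
    have e : ε⁻¹ * K ^ 10 * (ρ ^ 2 / K ^ 9) ^ 2 = (K ^ 10 * ρ ^ 2) ^ 2 / (ε * K ^ 28) := by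
      field_simp
    have e' : ε * (4 / K ^ 28) = 4 * ε ^ 2 / (ε * K ^ 28) := by field_simp
    rw [e, e', div_le_div_iff_of_pos_right (by positivity)]
    nlinarith [r3]
  · have a : 5 / K ^ 20 ≤ 1 / (2 * K ^ 19) := by
      rw [div_le_div_iff₀ hK20 (by positivity)]
      nlinarith [hK, hK19]
    have b : 4 / K ^ 28 ≤ 1 / (2 * K ^ 19) := by
      rw [div_le_div_iff₀ (by positivity) (by positivity)]
      nlinarith [h169, hK19]
    have e : 1 / (2 * K ^ 19) + 1 / (2 * K ^ 19) = 1 / K ^ 19 := by ring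
    linarith [a, b, e]

/-- §252 THE SHARP CLOCK INCREMENT LAW: on a window `[T, u]`, `u ≤ T + 3`, after a dousing
(`b(T) = -θε`, `0 ≤ θ ≤ 3/2`, `P(T) = P₀ ≤ 1/2`) with `c ≤ ρ²/K⁹` and `|d| ≤ d₁` on `[T, u]`:
`εs_l'(t - s) ≤ b(t) - b(s) ≤ εs_u'(t - s)` for `T ≤ s ≤ t ≤ u`, `s_l' = 1 - P₀ - 6d₁/K⁹ - 1/K¹⁹`,
`s_u' = 1 - P₀ + 6d₁/K⁹`: part 56 §168–§169 (`knob_pair_dose` at dose `d₁`: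
`|P - P₀| ≤ 2d₁(t - T)/K⁹ ≤ 6d₁/K⁹`; `b² + c² ≤ 5/K²⁰` by part 57 §172's crude clock;
`carrier_bracket`; `clock_bracket` with drag `μc² ≤ 4ε/K²⁸`). [derived: this file §252] -/
theorem knob_cold_increment_sharp
    (hX : ∀ t, HasDerivAt X (RotorKnob.rotorCircuit K (K ^ 10) ε ρ (X t)) t)
    (h0 : X 0 = delayInit) (hK : 16 ≤ K) (hε : 0 < ε) (hεK : ε ^ 2 ≤ 1 / (6 * K ^ 20))
    (hρ : 0 < ρ) (hhi : K ^ 10 * ρ ^ 2 ≤ 2 * ε) {T u θ P₀ d₁ : ℝ} (hT : 0 ≤ T)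
    (hu : u ≤ T + 3) (hθ : 0 ≤ θ) (hθ2 : θ ≤ 3 / 2) (hbT : X T 1 = -(θ * ε))
    (hP : X T 3 ^ 2 + X T 4 ^ 2 = P₀) (hP0 : P₀ ≤ 1 / 2)
    (hc : ∀ t ∈ Icc T u, X t 2 ≤ ρ ^ 2 / K ^ 9) (hd : ∀ t ∈ Icc T u, |X t 3| ≤ d₁)
    {s t : ℝ} (hs : s ∈ Icc T u) (ht : t ∈ Icc T u) (hst : s ≤ t) :
    ε * (1 - P₀ - 6 * d₁ / K ^ 9 - 1 / K ^ 19) * (t - s) ≤ X t 1 - X s 1 ∧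
      X t 1 - X s 1 ≤ ε * (1 - P₀ + 6 * d₁ / K ^ 9) * (t - s) := by
  have hK0 : (0 : ℝ) < K := by linarith
  have hK9 : (0 : ℝ) < K ^ 9 := by positivity
  obtain ⟨n1, n2, n3⟩ := sharp_cold_numerics hK hε hεK hρ hhi
  obtain ⟨-, h60, h61, hsl⟩ := cold_slopes hK hP0
  have hXf := hX
  rw [RotorKnob.rotorCircuit_eq_fiveGate] at hXf
  have hσ : (0 : ℝ) ≤ ρ ^ 2 * exp (-K ^ 10) := by positivity
  have hμ : (0 : ℝ) ≤ ε⁻¹ * K ^ 10 := by positivity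
  have hTu : T ∈ Icc T u := left_mem_Icc.2 (hs.1.trans hs.2)
  have hd0 : 0 ≤ d₁ := (abs_nonneg _).trans (hd T hTu)
  have hP00 : 0 ≤ P₀ := by rw [← hP]; positivity
  -- the pair at dose level `d₁` (part 56 §169 `knob_pair_dose`)
  have hpair : ∀ r ∈ Icc T u, |X r 3 ^ 2 + X r 4 ^ 2 - P₀| ≤ 6 * d₁ / K ^ 9 := by
    intro r hr
    have h := knob_pair_dose hX h0 hT hc hd hr
    rw [hP] at h
    have e : 2 * (ρ ^ 2)⁻¹ * (ρ ^ 2 / K ^ 9) * d₁ * (r - T) = 2 * d₁ * (r - T) / K ^ 9 := by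
      field_simp
    rw [e] at h
    refine h.trans (div_le_div_of_nonneg_right ?_ hK9.le)
    have h3 : 2 * d₁ * (r - T) ≤ 2 * d₁ * 3 :=
      mul_le_mul_of_nonneg_left (by linarith [hr.2, hu]) (by linarith [hd0])
    linarith [h3]
  -- the trigger and part 57 §172's crude clock: `b² + c² ≤ 25ε² + (ρ²/K⁹)² ≤ 5/K²⁰`
  have hc2 : ∀ r ∈ Icc T u, X r 2 ^ 2 ≤ (ρ ^ 2 / K ^ 9) ^ 2 := fun r hr =>
    pow_le_pow_left₀ (c_nonneg hXf h0 hσ (hT.trans hr.1)) (hc r hr) 2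
  have hη : ∀ r ∈ Icc T u, X r 1 ^ 2 + X r 2 ^ 2 ≤ 5 / K ^ 20 := by
    intro r hr
    obtain ⟨hl, hu'⟩ :=
      (knob_cold_brackets hX h0 hK hε hεK hρ hhi hT hu hθ hθ2 hbT hP hc hr).2.2
    have hrT : r - T ≤ 3 := by linarith [hr.2]
    have hrT0 : 0 ≤ r - T := by linarith [hr.1]
    have hθε : θ * ε ≤ 3 / 2 * ε := mul_le_mul_of_nonneg_right hθ2 hε.le
    have hlo : -(5 * ε) ≤ X r 1 := by
      have h1 : 0 ≤ ε * (1 - P₀ - 8 / K ^ 9) * (r - T) :=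
        mul_nonneg (mul_nonneg hε.le hsl.le) hrT0
      linarith [hl, h1, hθε, hε]
    have hhi' : X r 1 ≤ 5 * ε := by
      have h2 : 0 ≤ 1 - P₀ + 6 / K ^ 9 := by linarith [h60, hP0]
      have h1 : ε * (1 - P₀ + 6 / K ^ 9) * (r - T) ≤ ε * (1 - P₀ + 6 / K ^ 9) * 3 :=
        mul_le_mul_of_nonneg_left hrT (mul_nonneg hε.le h2)
      have h3 : ε * (1 - P₀ + 6 / K ^ 9) ≤ ε * (3 / 2) :=
        mul_le_mul_of_nonneg_left (by linarith [h61, hP00]) hε.le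
      linarith [hu', h1, h3, mul_nonneg hθ hε.le, hε]
    have hb3 : X r 1 ^ 2 ≤ (5 * ε) ^ 2 := sq_le_sq' hlo hhi'
    have e5 : (5 * ε) ^ 2 = 25 * ε ^ 2 := by ring
    linarith [hb3, e5, hc2 r hr, n1]
  -- the sharp carrier band (part 56 §168 `carrier_bracket`) and the clock bracket
  have hcar : ∀ r ∈ Icc T u, 1 - P₀ - 6 * d₁ / K ^ 9 - 5 / K ^ 20 ≤ X r 0 ^ 2 ∧
      X r 0 ^ 2 ≤ 1 - P₀ + 6 * d₁ / K ^ 9 := fun r hr =>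
    carrier_bracket hX h0 (hpair r hr) (hη r hr)
  obtain ⟨hl, hu'⟩ := clock_bracket hXf hε.le hμ hcar hc2 hs ht hst
  have hts : 0 ≤ t - s := sub_nonneg.2 hst
  have hdrag : ε⁻¹ * K ^ 10 * (ρ ^ 2 / K ^ 9) ^ 2 * (t - s) ≤ ε * (4 / K ^ 28) * (t - s) :=
    mul_le_mul_of_nonneg_right n2 hts
  have hn3 : ε * (5 / K ^ 20 + 4 / K ^ 28) * (t - s) ≤ ε * (1 / K ^ 19) * (t - s) :=
    mul_le_mul_of_nonneg_right (mul_le_mul_of_nonneg_left n3 hε.le) hts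
  have e : (ε * (1 - P₀ - 6 * d₁ / K ^ 9 - 5 / K ^ 20) - ε⁻¹ * K ^ 10 * (ρ ^ 2 / K ^ 9) ^ 2)
      * (t - s) = ε * (1 - P₀ - 6 * d₁ / K ^ 9 - 1 / K ^ 19) * (t - s)
        + (ε * (1 / K ^ 19) * (t - s) - ε * (5 / K ^ 20 + 4 / K ^ 28) * (t - s))
        + (ε * (4 / K ^ 28) * (t - s) - ε⁻¹ * K ^ 10 * (ρ ^ 2 / K ^ 9) ^ 2 * (t - s)) := by
    ring
  exact ⟨by linarith [hl, hdrag, hn3, e], hu'⟩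

/-! ## §253 The sharp debt: upper action parabola and the relight alternative -/

/-- §253 THE SHARP UPPER ACTION PARABOLA: under §252's hypotheses any clock action `B` (`B' = b`)
has `B(t) - B(T) ≤ ε(t - T)(s_u'(t - T)/2 - θ)` on `[T, u]` (`B - Φ` is antitone since
`b(r) ≤ -θε + εs_u'(r - T) = Φ'(r)`; part 58 §176 with the sharp slope).
[derived: this file §253] -/
theorem knob_cold_action_upper_sharp
    (hX : ∀ t, HasDerivAt X (RotorKnob.rotorCircuit K (K ^ 10) ε ρ (X t)) t)
    (h0 : X 0 = delayInit) (hK : 16 ≤ K) (hε : 0 < ε) (hεK : ε ^ 2 ≤ 1 / (6 * K ^ 20))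
    (hρ : 0 < ρ) (hhi : K ^ 10 * ρ ^ 2 ≤ 2 * ε) {T u θ P₀ d₁ : ℝ} (hT : 0 ≤ T)
    (hu : u ≤ T + 3) (hθ : 0 ≤ θ) (hθ2 : θ ≤ 3 / 2) (hbT : X T 1 = -(θ * ε))
    (hP : X T 3 ^ 2 + X T 4 ^ 2 = P₀) (hP0 : P₀ ≤ 1 / 2)
    (hc : ∀ t ∈ Icc T u, X t 2 ≤ ρ ^ 2 / K ^ 9) (hd : ∀ t ∈ Icc T u, |X t 3| ≤ d₁)
    {B : ℝ → ℝ} (hB : ∀ t, HasDerivAt B (X t 1) t) {t : ℝ} (ht : t ∈ Icc T u) :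
    B t - B T ≤ ε * ((t - T) * ((1 - P₀ + 6 * d₁ / K ^ 9) * (t - T) / 2 - θ)) := by
  have hTI : T ∈ Icc T u := left_mem_Icc.2 (ht.1.trans ht.2)
  have hcl : ∀ r ∈ Icc T u,
      X r 1 ≤ -(θ * ε) + ε * (1 - P₀ + 6 * d₁ / K ^ 9) * (r - T) := by
    intro r hr
    have h := (knob_cold_increment_sharp hX h0 hK hε hεK hρ hhi hT hu hθ hθ2 hbT hP hP0 hc hd
      hTI hr hr.1).2
    rw [hbT] at h
    linarith [h]
  have hΦ : ∀ s r : ℝ, HasDerivAt (fun r => ε * ((r - T) * (s * (r - T) / 2 - θ)))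
      (-(θ * ε) + ε * s * (r - T)) r := by
    intro s r
    have h1 : HasDerivAt (fun r => r - T) 1 r := (hasDerivAt_id r).sub_const T
    exact ((h1.mul (((h1.const_mul s).div_const 2).sub_const θ)).const_mul ε).congr_deriv
      (by ring)
  have hm := Thm53.antitoneOn_sub_of_deriv_le (convex_Icc T u) (fun r _ => hB r)
    (fun r _ => hΦ (1 - P₀ + 6 * d₁ / K ^ 9) r) (fun r hr => hcl r hr)
  have h := hm hTI ht ht.1
  simp only [sub_self, zero_mul, mul_zero, sub_zero] at h
  linarith

/-- §253 THE SHARP RELIGHT ALTERNATIVE: after a dousing at `T` (`b(T) = -θε`, `0 ≤ θ ≤ 3/2`,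
`P(T) = P₀ ≤ 1/2`, `c(T) ≤ 2ρ²/K¹⁰`) with `c ≤ ρ²/K⁹` and `|d| ≤ d₁` on `[T, r]`, a clock
zero `tz ∈ [T, r]` and `c(r) = ρ²/K⁹`: either the sharp debt is repaid, `r > T + 2θ/s_u'`, or
the seed has been amplified, `s_u(r - tz)²/2 > 1 - 10 log K/K¹⁰` (else `B(r) ≤ B(T)` by the
sharp parabola and part 58 §179 caps `c(r) ≤ c(T) + 3ρ²/K¹⁰ < ρ²/K⁹`; part 60 §185 re-read).
[derived: this file §253] -/
theorem knob_relight_lower_sharp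
    (hX : ∀ t, HasDerivAt X (RotorKnob.rotorCircuit K (K ^ 10) ε ρ (X t)) t)
    (h0 : X 0 = delayInit) (hK : 16 ≤ K) (hε : 0 < ε) (hεK : ε ^ 2 ≤ 1 / (6 * K ^ 20))
    (hρ : 0 < ρ) (hhi : K ^ 10 * ρ ^ 2 ≤ 2 * ε) {T r θ P₀ d₁ : ℝ} (hT : 0 ≤ T)
    (hr : r ≤ T + 3) (hθ : 0 ≤ θ) (hθ2 : θ ≤ 3 / 2) (hbT : X T 1 = -(θ * ε))
    (hP : X T 3 ^ 2 + X T 4 ^ 2 = P₀) (hc : ∀ t ∈ Icc T r, X t 2 ≤ ρ ^ 2 / K ^ 9)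
    (hd : ∀ t ∈ Icc T r, |X t 3| ≤ d₁) (hP0 : P₀ ≤ 1 / 2)
    (hcT : X T 2 ≤ 2 * ρ ^ 2 / K ^ 10) {tz : ℝ} (htz : tz ∈ Icc T r) (hz : X tz 1 = 0)
    (hcr : X r 2 = ρ ^ 2 / K ^ 9) :
    T + 2 * θ / (1 - P₀ + 6 * d₁ / K ^ 9) < r ∨
      1 - 10 * log K / K ^ 10 < (1 - P₀ + 6 / K ^ 9) * (r - tz) ^ 2 / 2 := by
  have hK0 : (0 : ℝ) < K := by linarith
  obtain ⟨-, n2, -, -⟩ := relight_numerics hK hρ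
  have hTr : T ≤ r := htz.1.trans htz.2
  have hrI : r ∈ Icc T r := right_mem_Icc.2 hTr
  have hd0 : 0 ≤ d₁ := (abs_nonneg _).trans (hd T (left_mem_Icc.2 hTr))
  have hsu : 0 < 1 - P₀ + 6 * d₁ / K ^ 9 := by
    have : 0 ≤ 6 * d₁ / K ^ 9 := by positivity
    linarith only [hP0, this]
  have hXf := hX
  rw [RotorKnob.rotorCircuit_eq_fiveGate] at hXf
  obtain ⟨B, hB⟩ := exists_clock_action hXf
  by_contra hnot
  obtain ⟨h1, h2⟩ := not_or.1 hnot
  have h1 := not_lt.1 h1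
  have h2 := not_lt.1 h2
  have hact := knob_cold_action_upper_sharp hX h0 hK hε hεK hρ hhi hT hr hθ hθ2 hbT hP hP0 hc
    hd hB hrI
  have hx : (r - T) * (1 - P₀ + 6 * d₁ / K ^ 9) ≤ 2 * θ :=
    (le_div_iff₀ hsu).1 (by linarith only [h1])
  have hnn : 0 ≤ (r - T) * (θ - (1 - P₀ + 6 * d₁ / K ^ 9) * (r - T) / 2) :=
    mul_nonneg (by linarith only [hTr]) (by linarith only [hx])
  have hBr : B r ≤ B T := by linarith only [hact, mul_nonneg hε.le hnn]
  have hq2 := knob_cold_quiet_seed hX h0 hK hε hεK hρ hhi hT hr hθ hθ2 hbT hP hc hP0 hB htz hz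
    hrI hBr h2
  linarith only [hq2, hcr, n2, hcT]

end Summit.NavierStokesRegularity.FluidComputer.GateBudget

end
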